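import Summits.Ventures.YMGap.FlowData.TubeTransferBilinearReduction
import Summits.Ventures.YMGap.FlowData.TubeTransferPositivity
import Literature.MathematicalPhysics.QuantumFieldTheory.FlatLatticeGaugeFields
import Literature.Analysis.OperatorTheory.PathKernelDomination

/-!
# Venture YMGap, track Y3 FLOW-DATA — the Gauss-law kinetic operator is DOMINATED by the un-averaged link weight:
# `⟪z, 𝒦 z⟫ = ∫ ⟪z ∘ (·)^E, W z⟫ dE ≤ ⟪z, W z⟫` (theorems only)

HONEST FRAMING: venture file of the cell `pub-ymgap` (QuantumFields programme), track Y3, lineage A (seat flow-eng-1).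
Finite Haar integrals over `G^{links}` of one time slice of the tube `(ℤ/L)^k` (compact second-countable `G`, continuous
unitary `ρ`); no number, no row, nothing about `L → ∞`, the continuum or a mass gap.

WHY.  The operator-level kept-set tail theorem (`KWeightTailOperator`, files 1–8) has every operator-side hypothesis for
the typed tube discharged except the DROPPED BOUND `⟪z, 𝒦 z⟫ ≤ κ‖z‖²` off the kept family, `𝒦` the Gauss-law kinetic
operator of `KWeightTailTubeKinetic` (kernel `k(a,b) = ∫ e^{J elecSum(a,E,b)} dE`).  The bound is available for the
UN-AVERAGED weight `W` (kernel `w(a,b) = e^{J elecSum(a,1,b)}`; `KWeightTailTubeCharProj` + `KWeightTailOperatorDropped`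
for SU(2)).  This file supplies the comparison, WITHOUT constructing the gauge-averaging projection:

* `exists_unaveragedOp`, `inner_unaveragedOp_self_nonneg` (`J ≥ 0`, Lüscher's positive type `posType_exp_elecSum_one`),
  `abs_inner_le_of_nonneg_form` (Cauchy–Schwarz for a non-negative symmetric form, abstract);
* **`inner_kineticOp_eq_integral_gaugeTransform`** — `⟪z, 𝒦 z⟫ = ∫ (∫ z(a^E) ∫ w(a,b) z(b) db da) dE`
  (the temporal links as a gauge transformation of the earlier slice, Fubini twice, and the measure-preserving change of
  variables `a ↦ a^E`);
* `integral_comp_mul_unaveraged_le` — each `E`-slice is `≤ ⟪z, W z⟫` (Cauchy–Schwarz and the invariance of the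
  un-averaged form under simultaneous gauge transformations);
* **`inner_kineticOp_le_inner_unaveraged`** — `⟪z, 𝒦 z⟫ ≤ ⟪z, W z⟫` for every `z ∈ L²` (`J ≥ 0`): so a dropped bound for `W`
  off the kept isotypic components is one for `𝒦`.

WHAT IS NOT HERE: that `𝒦` kills functions of vanishing gauge average (`𝒦 = W Π`), the spanning fact (the engine's nets
together with such functions exhaust the kept isotypic components); numbers.

References: M. Lüscher, Commun. Math. Phys. 54 (1977) 283 [cite: Luscher1977]; M. Creutz, *Quarks, gluons and lattices* (1983)
Ch. 9; I. Montvay, G. Münster (1994) §3.2.6 [cite: MontvayMunster1994, §3.2.6].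
-/

noncomputable section

open scoped BigOperators ENNReal RealInnerProductSpace
open MeasureTheory Filter Function
open Literature.MathematicalPhysics.QuantumFieldTheory Literature.Analysis.OperatorTheory

namespace Summit.Ventures.YMGap.FlowData

namespace KWeightTailOperator

/-! ### Cauchy–Schwarz for a non-negative symmetric form (abstract) -/

section CauchySchwarz

variable {H : Type*} [NormedAddCommGroup H] [InnerProductSpace ℝ H]

/-- **Cauchy–Schwarz for a non-negative symmetric form**: if `⟪x, B y⟫ = ⟪y, B x⟫` and `0 ≤ ⟪x, B x⟫` for all `x, y`,
then `|⟪x, B y⟫| ≤ (⟪x, B x⟫ + ⟪y, B y⟫)/2` (the arithmetic-mean form, enough for equal diagonal values). [folklore] -/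
theorem abs_inner_le_of_nonneg_form (B : H →L[ℝ] H) (hsym : ∀ x y : H, ⟪x, B y⟫ = ⟪y, B x⟫)
    (hpos : ∀ x : H, 0 ≤ ⟪x, B x⟫) (x y : H) : |⟪x, B y⟫| ≤ (⟪x, B x⟫ + ⟪y, B y⟫) / 2 := by
  have h1 := hpos (x - y)
  have h2 := hpos (x + y)
  rw [map_sub, inner_sub_left, inner_sub_right, inner_sub_right] at h1
  rw [map_add, inner_add_left, inner_add_right, inner_add_right] at h2
  rw [hsym y x] at h1 h2
  rw [abs_le]
  constructor <;> linarith

end CauchySchwarz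

/-! ### The un-averaged weight operator of the tube and its invariance -/

section Unaveraged

variable {G : Type*} [Group G] [TopologicalSpace G] [IsTopologicalGroup G] [CompactSpace G]
  [MeasurableSpace G] [BorelSpace G] [SecondCountableTopology G] {n : ℕ} (ρ : G →* Matrix (Fin n) (Fin n) ℂ)
  (J : ℝ) (k L : ℕ) [NeZero L]

omit [CompactSpace G] [MeasurableSpace G] [BorelSpace G] [SecondCountableTopology G] in
/-- The un-averaged kernel `(a,b) ↦ e^{J elecSum(a,1,b)}` is jointly continuous. [folklore] -/
theorem continuous_unaveragedKernel (hρ : Continuous ρ) :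
    Continuous fun p : GaugeConfig k L G × GaugeConfig k L G =>
      Real.exp (J * elecSum (d := k) (L := L) ρ p.1 1 p.2) :=
  Continuous.comp (g := fun q : (GaugeConfig k L G × (Site k L → G)) × GaugeConfig k L G =>
      Real.exp (J * elecSum (d := k) (L := L) ρ q.1.1 q.1.2 q.2))
    (f := fun p : GaugeConfig k L G × GaugeConfig k L G => ((p.1, (1 : Site k L → G)), p.2))
    (continuous_exp_elecSum_pair ρ J hρ) ((continuous_fst.prodMk continuous_const).prodMk continuous_snd)

/-- **The un-averaged weight operator exists**: a bounded `W` on `L²(slice)` with `(W φ)(a) = ∫ e^{J elecSum(a,1,b)} φ(b) db`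
a.e. (tree `exists_kernelOp`). [folklore] -/
theorem exists_unaveragedOp (hρ : Continuous ρ) :
    ∃ W : Lp ℝ 2 (sliceMeasure G k L) →L[ℝ] Lp ℝ 2 (sliceMeasure G k L),
      ∀ φ : Lp ℝ 2 (sliceMeasure G k L), (W φ : GaugeConfig k L G → ℝ) =ᵐ[sliceMeasure G k L]
        fun a => ∫ b, Real.exp (J * elecSum (d := k) (L := L) ρ a 1 b) * φ b ∂(sliceMeasure G k L) := by
  obtain ⟨C, hC⟩ := isCompact_univ.exists_bound_of_continuousOn (continuous_unaveragedKernel ρ J k L hρ).continuousOn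
  exact exists_kernelOp (μ := sliceMeasure G k L)
    (K := fun a b : GaugeConfig k L G => Real.exp (J * elecSum (d := k) (L := L) ρ a 1 b))
    (continuous_unaveragedKernel ρ J k L hρ).stronglyMeasurable (C := C) fun a b => hC (a, b) (Set.mem_univ _)

variable {ρ J k L}

/-- **`W ⪰ 0` in quadratic form** for `J ≥ 0` (Lüscher's positive type of the un-averaged kernel,
`posType_exp_elecSum_one`, passed to `L²` by `inner_kernelOp_self_nonneg`). [cite: Luscher1977] -/
theorem inner_unaveragedOp_self_nonneg (hρ : Continuous ρ) (hρu : ∀ g, ρ g ∈ Matrix.unitaryGroup (Fin n) ℂ)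
    (hJ : 0 ≤ J) {W : Lp ℝ 2 (sliceMeasure G k L) →L[ℝ] Lp ℝ 2 (sliceMeasure G k L)}
    (hW : ∀ φ : Lp ℝ 2 (sliceMeasure G k L), (W φ : GaugeConfig k L G → ℝ) =ᵐ[sliceMeasure G k L]
      fun a => ∫ b, Real.exp (J * elecSum (d := k) (L := L) ρ a 1 b) * φ b ∂(sliceMeasure G k L))
    (z : Lp ℝ 2 (sliceMeasure G k L)) : 0 ≤ ⟪z, W z⟫ := by
  refine inner_kernelOp_self_nonneg hW (fun f hf hf1 => ?_) z
  set μ := sliceMeasure G k L with hμ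
  set c : ℝ := ∑ _x : Site k L, ∑ _i : Fin k, (n : ℝ) with hc
  have h := posType_exp_elecSum_one ρ hρ hρu hJ f hf hf1
  -- integrability of `f(a) K(a,b) f(b)` on the product
  have hfi : Integrable f μ :=
    (memLp_top_of_bound hf.aestronglyMeasurable 1 (Eventually.of_forall fun x => by
      rw [Real.norm_eq_abs]; exact hf1 x)).integrable le_top
  obtain ⟨B, hB⟩ := isCompact_univ.exists_bound_of_continuousOn
    (continuous_unaveragedKernel ρ J k L hρ).continuousOn
  have hint : Integrable (fun q : GaugeConfig k L G × GaugeConfig k L G =>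
      f q.1 * Real.exp (J * elecSum (d := k) (L := L) ρ q.1 1 q.2) * f q.2) (μ.prod μ) := by
    refine ((hfi.mul_prod hfi).bdd_mul (continuous_unaveragedKernel ρ J k L hρ).aestronglyMeasurable (c := B)
      (Eventually.of_forall fun q => hB q (Set.mem_univ _))).congr (Eventually.of_forall fun q => ?_)
    ring
  have hprod := integral_prod _ hint
  simp only at hprod
  rw [← hprod]
  -- factor `e^{J c}` out of the shifted positive-type statement
  have hsplit : ∀ q : GaugeConfig k L G × GaugeConfig k L G,
      f q.1 * Real.exp (J * elecSum (d := k) (L := L) ρ q.1 1 q.2) * f q.2 =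
        Real.exp (J * c) * (f q.1 * Real.exp (J * (elecSum (d := k) (L := L) ρ q.1 1 q.2 - c)) * f q.2) := by
    intro q
    rw [mul_sub, Real.exp_sub]
    field_simp
  simp_rw [hsplit]
  rw [integral_const_mul]
  exact mul_nonneg (Real.exp_pos _).le h

omit [CompactSpace G] [MeasurableSpace G] [BorelSpace G] [SecondCountableTopology G] [TopologicalSpace G]
  [IsTopologicalGroup G] in
/-- The un-averaged kernel is symmetric (unitary `ρ`): `e^{J elecSum(a,1,b)} = e^{J elecSum(b,1,a)}`. [folklore] -/
theorem unaveragedKernel_symm (hρu : ∀ g, ρ g ∈ Matrix.unitaryGroup (Fin n) ℂ) (a b : GaugeConfig k L G) :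
    Real.exp (J * elecSum (d := k) (L := L) ρ a 1 b) = Real.exp (J * elecSum (d := k) (L := L) ρ b 1 a) := by
  have h := elecSum_swap_inv (d := k) (L := L) ρ hρu b a 1
  rw [inv_one] at h
  rw [h]

omit [CompactSpace G] [MeasurableSpace G] [BorelSpace G] [SecondCountableTopology G] [TopologicalSpace G]
  [IsTopologicalGroup G] in
/-- The un-averaged kernel is invariant under SIMULTANEOUS gauge transformations of both slices. [folklore] -/
theorem unaveragedKernel_gaugeTransform (γ : Site k L → G) (a b : GaugeConfig k L G) :
    Real.exp (J * elecSum (d := k) (L := L) ρ (gaugeTransform γ a) 1 (gaugeTransform γ b)) =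
      Real.exp (J * elecSum (d := k) (L := L) ρ a 1 b) := by
  have h := elecSum_gaugeTransform_div (k := k) (L := L) ρ γ γ a b
  rw [div_self'] at h
  rw [h]

/-- The form of the un-averaged weight operator is symmetric. [folklore] -/
theorem inner_unaveragedOp_comm (hρ : Continuous ρ) (hρu : ∀ g, ρ g ∈ Matrix.unitaryGroup (Fin n) ℂ)
    {W : Lp ℝ 2 (sliceMeasure G k L) →L[ℝ] Lp ℝ 2 (sliceMeasure G k L)}
    (hW : ∀ φ : Lp ℝ 2 (sliceMeasure G k L), (W φ : GaugeConfig k L G → ℝ) =ᵐ[sliceMeasure G k L]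
      fun a => ∫ b, Real.exp (J * elecSum (d := k) (L := L) ρ a 1 b) * φ b ∂(sliceMeasure G k L))
    (x y : Lp ℝ 2 (sliceMeasure G k L)) : ⟪x, W y⟫ = ⟪y, W x⟫ := by
  obtain ⟨C, hC⟩ := isCompact_univ.exists_bound_of_continuousOn (continuous_unaveragedKernel ρ J k L hρ).continuousOn
  have hsa : IsSelfAdjoint W :=
    isSelfAdjoint_kernelOp (K := fun a b : GaugeConfig k L G => Real.exp (J * elecSum (d := k) (L := L) ρ a 1 b))
      (continuous_unaveragedKernel ρ J k L hρ).stronglyMeasurable (C := C) (fun a b => hC (a, b) (Set.mem_univ _))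
      (unaveragedKernel_symm hρu) hW
  have h := hsa.isSymmetric y x
  simp only [ContinuousLinearMap.coe_coe] at h
  rw [← h, real_inner_comm]

/-- **Invariance of the un-averaged form under simultaneous gauge transformations**: if `y = z ∘ (·)^γ` a.e. then
`⟪y, W y⟫ = ⟪z, W z⟫` (the kernel is invariant and `(a,b) ↦ (a^γ, b^γ)` preserves the product slice measure). [folklore] -/
theorem inner_unaveragedOp_comp_gaugeTransform (hρ : Continuous ρ)
    {W : Lp ℝ 2 (sliceMeasure G k L) →L[ℝ] Lp ℝ 2 (sliceMeasure G k L)}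
    (hW : ∀ φ : Lp ℝ 2 (sliceMeasure G k L), (W φ : GaugeConfig k L G → ℝ) =ᵐ[sliceMeasure G k L]
      fun a => ∫ b, Real.exp (J * elecSum (d := k) (L := L) ρ a 1 b) * φ b ∂(sliceMeasure G k L))
    (γ : Site k L → G) {y z : Lp ℝ 2 (sliceMeasure G k L)}
    (hy : (y : GaugeConfig k L G → ℝ) =ᵐ[sliceMeasure G k L] fun a => z (gaugeTransform γ a)) :
    ⟪y, W y⟫ = ⟪z, W z⟫ := by
  obtain ⟨C, hC⟩ := isCompact_univ.exists_bound_of_continuousOn (continuous_unaveragedKernel ρ J k L hρ).continuousOn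
  have hKm : StronglyMeasurable (uncurry fun a b : GaugeConfig k L G =>
      Real.exp (J * elecSum (d := k) (L := L) ρ a 1 b)) :=
    (continuous_unaveragedKernel ρ J k L hρ).stronglyMeasurable
  have hC' : ∀ a b : GaugeConfig k L G, ‖Real.exp (J * elecSum (d := k) (L := L) ρ a 1 b)‖ ≤ C :=
    fun a b => hC (a, b) (Set.mem_univ _)
  have hmp : MeasurePreserving (gaugeTransform γ : GaugeConfig k L G → GaugeConfig k L G) (sliceMeasure G k L)
      (sliceMeasure G k L) := WilsonGauge.measurePreserving_gaugeTransform γ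
  -- both forms as integrals over the product measure
  have hprod : ∀ x : Lp ℝ 2 (sliceMeasure G k L), ⟪x, W x⟫ = ∫ q : GaugeConfig k L G × GaugeConfig k L G,
      x q.1 * (Real.exp (J * elecSum (d := k) (L := L) ρ q.1 1 q.2) * x q.2) ∂((sliceMeasure G k L).prod (sliceMeasure G k L)) := by
    intro x
    rw [inner_kernelOp_eq_integral hW x x, integral_prod _ (integrable_mul_kernel_mul hKm hC' x x)]
    refine integral_congr_ae (Eventually.of_forall fun a => ?_)
    simp only
    rw [← integral_const_mul]
  rw [hprod y, hprod z]
  -- replace `y` by `z ∘ γ` on the product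
  have hy1 : (fun q : GaugeConfig k L G × GaugeConfig k L G => (y : GaugeConfig k L G → ℝ) q.1) =ᵐ[(sliceMeasure G k L).prod (sliceMeasure G k L)]
      fun q => z (gaugeTransform γ q.1) :=
    (Measure.quasiMeasurePreserving_fst (μ := sliceMeasure G k L) (ν := sliceMeasure G k L)).ae_eq_comp hy
  have hy2 : (fun q : GaugeConfig k L G × GaugeConfig k L G => (y : GaugeConfig k L G → ℝ) q.2) =ᵐ[(sliceMeasure G k L).prod (sliceMeasure G k L)]
      fun q => z (gaugeTransform γ q.2) :=
    (Measure.quasiMeasurePreserving_snd (μ := sliceMeasure G k L) (ν := sliceMeasure G k L)).ae_eq_comp hy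
  have heq : (fun q : GaugeConfig k L G × GaugeConfig k L G =>
      (y : GaugeConfig k L G → ℝ) q.1 * (Real.exp (J * elecSum (d := k) (L := L) ρ q.1 1 q.2) * y q.2)) =ᵐ[(sliceMeasure G k L).prod (sliceMeasure G k L)]
      fun q => (fun q' : GaugeConfig k L G × GaugeConfig k L G =>
        (z : GaugeConfig k L G → ℝ) q'.1 * (Real.exp (J * elecSum (d := k) (L := L) ρ q'.1 1 q'.2) * z q'.2))
        (gaugeTransform γ q.1, gaugeTransform γ q.2) := by
    filter_upwards [hy1, hy2] with q h1 h2
    rw [h1, h2, unaveragedKernel_gaugeTransform]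
  rw [integral_congr_ae heq]
  -- change of variables on the product
  have hmp2 : MeasurePreserving (fun q : GaugeConfig k L G × GaugeConfig k L G =>
      (gaugeTransform γ q.1, gaugeTransform γ q.2)) ((sliceMeasure G k L).prod (sliceMeasure G k L)) ((sliceMeasure G k L).prod (sliceMeasure G k L)) := hmp.prod hmp
  have hΨ : AEStronglyMeasurable (fun q' : GaugeConfig k L G × GaugeConfig k L G =>
      (z : GaugeConfig k L G → ℝ) q'.1 * (Real.exp (J * elecSum (d := k) (L := L) ρ q'.1 1 q'.2) * z q'.2))
      (Measure.map (fun q : GaugeConfig k L G × GaugeConfig k L G => (gaugeTransform γ q.1, gaugeTransform γ q.2))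
        ((sliceMeasure G k L).prod (sliceMeasure G k L))) := by
    rw [hmp2.map_eq]
    exact (integrable_mul_kernel_mul hKm hC' z z).aestronglyMeasurable
  have h := integral_map hmp2.measurable.aemeasurable hΨ
  rw [hmp2.map_eq] at h
  exact h.symm

/-- **`⟪z, 𝒦 z⟫ = ∫ ⟪z ∘ (·)^E, W z⟫ dE`**: the Gauss-law kinetic form is the average over the temporal links of the
un-averaged form between `z` and its gauge transforms (kernel formula, Fubini twice, and the change of variables
`a ↦ a^E` on the earlier slice, `elecSum(a^E, E, b) = elecSum(a, 1, b)`). [cite: Luscher1977] -/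
theorem inner_kineticOp_eq_integral_gaugeTransform (hρ : Continuous ρ) (hρu : ∀ g, ρ g ∈ Matrix.unitaryGroup (Fin n) ℂ)
    {𝒦 : Lp ℝ 2 (sliceMeasure G k L) →L[ℝ] Lp ℝ 2 (sliceMeasure G k L)}
    (h𝒦 : ∀ φ : Lp ℝ 2 (sliceMeasure G k L), (𝒦 φ : GaugeConfig k L G → ℝ) =ᵐ[sliceMeasure G k L]
      fun a => ∫ b, (∫ E, Real.exp (J * elecSum (d := k) (L := L) ρ a E b)
        ∂(Measure.pi fun _ : Site k L => haarProbability G)) * φ b ∂(sliceMeasure G k L))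
    (z : Lp ℝ 2 (sliceMeasure G k L)) :
    ⟪z, 𝒦 z⟫ = ∫ E, (∫ a, (z : GaugeConfig k L G → ℝ) (gaugeTransform E a) *
        ∫ b, Real.exp (J * elecSum (d := k) (L := L) ρ a 1 b) * z b ∂(sliceMeasure G k L) ∂(sliceMeasure G k L))
      ∂(Measure.pi fun _ : Site k L => haarProbability G) := by
  have hzi : Integrable (z : GaugeConfig k L G → ℝ) (sliceMeasure G k L) := (Lp.memLp z).integrable one_le_two
  set CE : ℝ := Real.exp (|J| * (n * Fintype.card (Edge k L))) with hCE
  have hexp_le : ∀ a b E, Real.exp (J * elecSum (d := k) (L := L) ρ a E b) ≤ CE := fun a b E =>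
    exp_elecSum_le ρ J hρu a b E
  have hexp_nn : ∀ a b E, 0 ≤ Real.exp (J * elecSum (d := k) (L := L) ρ a E b) := fun a b E => (Real.exp_pos _).le
  rw [inner_kernelOp_eq_integral h𝒦 z z]
  -- Step 1: for fixed `a`, swap the `b` and `E` integrals
  set F : GaugeConfig k L G → (Site k L → G) → ℝ := fun a E =>
    ∫ b, Real.exp (J * elecSum (d := k) (L := L) ρ a E b) * z b ∂(sliceMeasure G k L) with hF
  have hstep1 : ∀ a : GaugeConfig k L G,
      ∫ b, (∫ E, Real.exp (J * elecSum (d := k) (L := L) ρ a E b) ∂(Measure.pi fun _ : Site k L => haarProbability G)) *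
        z b ∂(sliceMeasure G k L) = ∫ E, F a E ∂(Measure.pi fun _ : Site k L => haarProbability G) := by
    intro a
    have h1 : ∀ b, (∫ E, Real.exp (J * elecSum (d := k) (L := L) ρ a E b) ∂(Measure.pi fun _ : Site k L =>
        haarProbability G)) * z b = ∫ E, Real.exp (J * elecSum (d := k) (L := L) ρ a E b) * z b
          ∂(Measure.pi fun _ : Site k L => haarProbability G) := fun b =>
      (integral_mul_const ((z : GaugeConfig k L G → ℝ) b) _).symm
    simp_rw [h1]
    have hc : Continuous fun p : GaugeConfig k L G × (Site k L → G) =>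
        Real.exp (J * elecSum (d := k) (L := L) ρ a p.2 p.1) :=
      Continuous.comp (g := fun q : (GaugeConfig k L G × (Site k L → G)) × GaugeConfig k L G =>
          Real.exp (J * elecSum (d := k) (L := L) ρ q.1.1 q.1.2 q.2))
        (f := fun p : GaugeConfig k L G × (Site k L → G) => ((a, p.2), p.1))
        (continuous_exp_elecSum_pair ρ J hρ) ((continuous_const.prodMk continuous_snd).prodMk continuous_fst)
    have hint : Integrable (uncurry fun (b : GaugeConfig k L G) (E : Site k L → G) =>
        Real.exp (J * elecSum (d := k) (L := L) ρ a E b) * z b)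
        ((sliceMeasure G k L).prod (Measure.pi fun _ : Site k L => haarProbability G)) := by
      have h0 : Integrable (fun p : GaugeConfig k L G × (Site k L → G) => (z : GaugeConfig k L G → ℝ) p.1 * (1 : ℝ))
          ((sliceMeasure G k L).prod (Measure.pi fun _ : Site k L => haarProbability G)) :=
        hzi.mul_prod (integrable_const 1)
      have h0' := h0.bdd_mul hc.aestronglyMeasurable (c := CE)
        (Eventually.of_forall fun p => by rw [Real.norm_of_nonneg (hexp_nn _ _ _)]; exact hexp_le _ _ _)
      refine h0'.congr (Eventually.of_forall fun p => ?_)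
      simp only [uncurry, mul_one]
    exact integral_integral_swap hint
  simp_rw [hstep1]
  -- Step 2: swap the `a` and `E` integrals
  have hFc : Continuous (uncurry F) := by
    refine continuous_of_dominated (bound := fun b => CE * ‖(z : GaugeConfig k L G → ℝ) b‖) ?_ ?_ ?_ ?_
    · intro p
      exact (Continuous.comp (g := fun q : (GaugeConfig k L G × (Site k L → G)) × GaugeConfig k L G =>
          Real.exp (J * elecSum (d := k) (L := L) ρ q.1.1 q.1.2 q.2))
        (f := fun b : GaugeConfig k L G => (p, b))
        (continuous_exp_elecSum_pair ρ J hρ) (continuous_const.prodMk continuous_id)).aestronglyMeasurable.mul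
        hzi.aestronglyMeasurable
    · intro p
      refine Eventually.of_forall fun b => ?_
      rw [norm_mul, Real.norm_of_nonneg (hexp_nn _ _ _)]
      exact mul_le_mul_of_nonneg_right (hexp_le _ _ _) (norm_nonneg _)
    · exact hzi.norm.const_mul _
    · refine Eventually.of_forall fun b => ?_
      exact (Continuous.comp (g := fun q : (GaugeConfig k L G × (Site k L → G)) × GaugeConfig k L G =>
          Real.exp (J * elecSum (d := k) (L := L) ρ q.1.1 q.1.2 q.2))
        (f := fun p : GaugeConfig k L G × (Site k L → G) => (p, b))
        (continuous_exp_elecSum_pair ρ J hρ) (continuous_id.prodMk continuous_const)).mul continuous_const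
  have hFb : ∀ a E, ‖F a E‖ ≤ CE * ∫ b, |(z : GaugeConfig k L G → ℝ) b| ∂(sliceMeasure G k L) := by
    intro a E
    simp only [hF]
    rw [← integral_const_mul]
    refine norm_integral_le_of_norm_le (hzi.abs.const_mul _) (Eventually.of_forall fun b => ?_)
    rw [norm_mul, Real.norm_of_nonneg (hexp_nn _ _ _), Real.norm_eq_abs]
    exact mul_le_mul_of_nonneg_right (hexp_le _ _ _) (abs_nonneg _)
  have hstep2 : ∫ a, (z : GaugeConfig k L G → ℝ) a * ∫ E, F a E ∂(Measure.pi fun _ : Site k L => haarProbability G)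
      ∂(sliceMeasure G k L) =
      ∫ E, ∫ a, (z : GaugeConfig k L G → ℝ) a * F a E ∂(sliceMeasure G k L)
        ∂(Measure.pi fun _ : Site k L => haarProbability G) := by
    have h1 : ∀ a, (z : GaugeConfig k L G → ℝ) a * ∫ E, F a E ∂(Measure.pi fun _ : Site k L => haarProbability G) =
        ∫ E, (z : GaugeConfig k L G → ℝ) a * F a E ∂(Measure.pi fun _ : Site k L => haarProbability G) := fun a => by
      rw [← integral_const_mul]
    simp_rw [h1]
    have hint : Integrable (uncurry fun (a : GaugeConfig k L G) (E : Site k L → G) =>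
        (z : GaugeConfig k L G → ℝ) a * F a E)
        ((sliceMeasure G k L).prod (Measure.pi fun _ : Site k L => haarProbability G)) := by
      have h0 : Integrable (fun p : GaugeConfig k L G × (Site k L → G) => (z : GaugeConfig k L G → ℝ) p.1 * (1 : ℝ))
          ((sliceMeasure G k L).prod (Measure.pi fun _ : Site k L => haarProbability G)) :=
        hzi.mul_prod (integrable_const 1)
      have h0' := h0.mul_bdd hFc.aestronglyMeasurable (c := CE * ∫ b, |(z : GaugeConfig k L G → ℝ) b| ∂(sliceMeasure G k L))
        (Eventually.of_forall fun p => hFb p.1 p.2)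
      refine h0'.congr (Eventually.of_forall fun p => ?_)
      simp only [uncurry, mul_one]
    exact integral_integral_swap hint
  rw [hstep2]
  -- Step 3: for each `E`, move the temporal links onto the earlier slice: `a ↦ a^E`
  refine integral_congr_ae (Eventually.of_forall fun E => ?_)
  have hmp : MeasurePreserving (gaugeTransform E : GaugeConfig k L G → GaugeConfig k L G) (sliceMeasure G k L)
      (sliceMeasure G k L) := WilsonGauge.measurePreserving_gaugeTransform E
  set Ψ : GaugeConfig k L G → ℝ := fun a => (z : GaugeConfig k L G → ℝ) a * F a E with hΨ
  have hFE : Continuous fun a : GaugeConfig k L G => F a E :=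
    Continuous.comp (g := uncurry F) (f := fun a : GaugeConfig k L G => (a, E)) hFc (continuous_id.prodMk continuous_const)
  have hΨm : AEStronglyMeasurable Ψ (sliceMeasure G k L) :=
    (Lp.aestronglyMeasurable z).mul hFE.aestronglyMeasurable
  have h1 : ∫ a, Ψ a ∂(sliceMeasure G k L) = ∫ a, Ψ (gaugeTransform E a) ∂(sliceMeasure G k L) := by
    have hΨm' : AEStronglyMeasurable Ψ (Measure.map (gaugeTransform E) (sliceMeasure G k L)) := by
      rw [hmp.map_eq]; exact hΨm
    have h := integral_map hmp.measurable.aemeasurable hΨm'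
    rw [hmp.map_eq] at h
    exact h
  simp only at h1 ⊢
  rw [h1]
  refine integral_congr_ae (Eventually.of_forall fun a => ?_)
  simp only [hΨ, hF]
  simp_rw [elecSum_gaugeTransform_left_self ρ E a]

/-- **Each temporal-link slice is dominated**: `∫ z(a^γ) (∫ e^{J elecSum(a,1,b)} z(b) db) da ≤ ⟪z, W z⟫` for `J ≥ 0`
(Cauchy–Schwarz for the non-negative un-averaged form and its invariance under simultaneous gauge transformations).
[folklore] -/
theorem integral_comp_mul_unaveraged_le (hρ : Continuous ρ) (hρu : ∀ g, ρ g ∈ Matrix.unitaryGroup (Fin n) ℂ)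
    (hJ : 0 ≤ J) {W : Lp ℝ 2 (sliceMeasure G k L) →L[ℝ] Lp ℝ 2 (sliceMeasure G k L)}
    (hW : ∀ φ : Lp ℝ 2 (sliceMeasure G k L), (W φ : GaugeConfig k L G → ℝ) =ᵐ[sliceMeasure G k L]
      fun a => ∫ b, Real.exp (J * elecSum (d := k) (L := L) ρ a 1 b) * φ b ∂(sliceMeasure G k L))
    (γ : Site k L → G) (z : Lp ℝ 2 (sliceMeasure G k L)) :
    ∫ a, (z : GaugeConfig k L G → ℝ) (gaugeTransform γ a) *
        ∫ b, Real.exp (J * elecSum (d := k) (L := L) ρ a 1 b) * z b ∂(sliceMeasure G k L) ∂(sliceMeasure G k L) ≤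
      ⟪z, W z⟫ := by
  have hmp : MeasurePreserving (gaugeTransform γ : GaugeConfig k L G → GaugeConfig k L G) (sliceMeasure G k L)
      (sliceMeasure G k L) := WilsonGauge.measurePreserving_gaugeTransform γ
  set y : Lp ℝ 2 (sliceMeasure G k L) := Lp.compMeasurePreserving (gaugeTransform γ) hmp z with hydef
  have hy : (y : GaugeConfig k L G → ℝ) =ᵐ[sliceMeasure G k L] fun a => z (gaugeTransform γ a) :=
    Lp.coeFn_compMeasurePreserving z hmp
  have h1 : ∫ a, (z : GaugeConfig k L G → ℝ) (gaugeTransform γ a) *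
      ∫ b, Real.exp (J * elecSum (d := k) (L := L) ρ a 1 b) * z b ∂(sliceMeasure G k L) ∂(sliceMeasure G k L) =
      ⟪y, W z⟫ := by
    rw [inner_kernelOp_eq_integral hW y z]
    refine integral_congr_ae ?_
    filter_upwards [hy] with a ha
    rw [ha]
  rw [h1]
  have hcs := abs_inner_le_of_nonneg_form W (inner_unaveragedOp_comm hρ hρu hW)
    (inner_unaveragedOp_self_nonneg hρ hρu hJ hW) y z
  have hinv : ⟪y, W y⟫ = ⟪z, W z⟫ := inner_unaveragedOp_comp_gaugeTransform hρ hW γ hy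
  linarith [le_abs_self ⟪y, W z⟫]

/-- **THE GAUSS-LAW KINETIC OPERATOR IS DOMINATED BY THE UN-AVERAGED WEIGHT**: `⟪z, 𝒦 z⟫ ≤ ⟪z, W z⟫` for every
`z ∈ L²(slice)` (`J ≥ 0`, continuous unitary `ρ`) — so a dropped bound `⟪z, W z⟫ ≤ κ‖z‖²` off the kept isotypic
components (`KWeightTailOperatorDropped` + `KWeightTailTubeCharProj`) is one for `𝒦`. [cite: Luscher1977] -/
theorem inner_kineticOp_le_inner_unaveraged (hρ : Continuous ρ) (hρu : ∀ g, ρ g ∈ Matrix.unitaryGroup (Fin n) ℂ)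
    (hJ : 0 ≤ J) {𝒦 W : Lp ℝ 2 (sliceMeasure G k L) →L[ℝ] Lp ℝ 2 (sliceMeasure G k L)}
    (h𝒦 : ∀ φ : Lp ℝ 2 (sliceMeasure G k L), (𝒦 φ : GaugeConfig k L G → ℝ) =ᵐ[sliceMeasure G k L]
      fun a => ∫ b, (∫ E, Real.exp (J * elecSum (d := k) (L := L) ρ a E b)
        ∂(Measure.pi fun _ : Site k L => haarProbability G)) * φ b ∂(sliceMeasure G k L))
    (hW : ∀ φ : Lp ℝ 2 (sliceMeasure G k L), (W φ : GaugeConfig k L G → ℝ) =ᵐ[sliceMeasure G k L]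
      fun a => ∫ b, Real.exp (J * elecSum (d := k) (L := L) ρ a 1 b) * φ b ∂(sliceMeasure G k L))
    (z : Lp ℝ 2 (sliceMeasure G k L)) : ⟪z, 𝒦 z⟫ ≤ ⟪z, W z⟫ := by
  rw [inner_kineticOp_eq_integral_gaugeTransform hρ hρu h𝒦 z]
  have hle : ∀ E : Site k L → G, (∫ a, (z : GaugeConfig k L G → ℝ) (gaugeTransform E a) *
      ∫ b, Real.exp (J * elecSum (d := k) (L := L) ρ a 1 b) * z b ∂(sliceMeasure G k L) ∂(sliceMeasure G k L)) ≤
      ⟪z, W z⟫ := fun E => integral_comp_mul_unaveraged_le hρ hρu hJ hW E z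
  by_cases hI : Integrable (fun E : Site k L → G => ∫ a, (z : GaugeConfig k L G → ℝ) (gaugeTransform E a) *
      ∫ b, Real.exp (J * elecSum (d := k) (L := L) ρ a 1 b) * z b ∂(sliceMeasure G k L) ∂(sliceMeasure G k L))
      (Measure.pi fun _ : Site k L => haarProbability G)
  · calc _ ≤ ∫ _E : Site k L → G, ⟪z, W z⟫ ∂(Measure.pi fun _ : Site k L => haarProbability G) :=
          integral_mono hI (integrable_const _) hle
      _ = ⟪z, W z⟫ := by rw [integral_const, probReal_univ, one_smul]
  · rw [integral_undef hI]
    exact inner_unaveragedOp_self_nonneg hρ hρu hJ hW z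

end Unaveraged

end KWeightTailOperator

end Summit.Ventures.YMGap.FlowData
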